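import Mathlib
import Summits.Ventures.PercRepro2.Defs
import Summits.Ventures.PercRepro2.Independence
import Summits.Ventures.PercRepro2.Harris
import Summits.Ventures.PercRepro2.Graph
import Summits.Ventures.PercRepro2.Exploration
import Summits.Ventures.PercRepro2.Events
import Summits.Ventures.PercRepro2.FourFunctions
import Summits.Ventures.PercRepro2.Induced
import Summits.Ventures.PercRepro2.Frontier
import Summits.Ventures.PercRepro2.ObsIndependence
import Summits.Ventures.PercRepro2.BHK
import Summits.Ventures.PercRepro2.BHKEvents
import Summits.Ventures.PercRepro2.VdBKahn
import Summits.Ventures.PercRepro2.BHKAvoid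
import Summits.Ventures.PercRepro2.OrderPreservation
import Summits.Ventures.PercRepro2.OrderPreservationQuant
import Summits.Ventures.PercRepro2.Merge
import Summits.Ventures.PercRepro2.OrderPreservationUnion
import Summits.Ventures.PercRepro2.R2PrimeThreeReduction
import Summits.Ventures.PercRepro2.YBridge
import Summits.Ventures.PercRepro2.EdgeBHK
import Summits.Ventures.PercRepro2.N0
import Summits.Ventures.PercRepro2.Rungs
import Summits.Ventures.PercRepro2.HF2
import Summits.Ventures.PercRepro2.ZIdentities
import Summits.Ventures.PercRepro2.ZReduction
import Summits.Ventures.PercRepro2.Yu1Functionals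
import Summits.Ventures.PercRepro2.Yu1Events
import Summits.Ventures.PercRepro2.Yu1
import Summits.Ventures.PercRepro2.YDelta

/-!
# The reduction of record with ONE hypothesis: `R2′(3) ⇐ Z` (blind cell PercRepro2, p1)

After NEG-32/33 (the termwise pieces (Yu1Δ), (Yu2Δ) are false) the surviving crux is their SUM
`Z := (T_{l→h} − Δ_l) + (T_{h→l} − Δ_h) ≤ (P(PD, o ∈ C₁) + P(PD, o ∈ C₂)) · W / P(PD)`
(`YDelta.deltaL`, `YDelta.deltaH`, `ZDelta` in typer-1's `ZDelta.lean`). The proof of `scprime_of_Z`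
only ever used the sum of its two hypotheses, so:

* `deltaL_eq`, `deltaH_eq`: `YDelta.deltaL`/`deltaH` in the raw spelling of `ZIdentities.delta_split`;
* `scprime_of_Zsum`: the sum hypothesis (verbatim the body of `ZDelta`), (N0) via `n0`, the orders
  `P(a₃ ↔ b) ≤ P(a₁ ↔ b) ≤ P(a₂ ↔ b)` ⊢ `SCPrimeIneq p ends o a₃ a₁ a₂ b`;
* `r2prime3_of_Zsum`: ⊢ **R2′(3)** — `P(o ↔ {a₃, a₁, a₂}, o ↔ b) ≥ P(o ↔ {a₃, a₁, a₂}, a₃ ↔ b)`.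
-/

namespace Summit.Ventures.PercRepro2

open UnionCluster

section ZSum

variable {V : Type*} {E : Type*} [Fintype E] [DecidableEq E] [Fintype V] [DecidableEq V]
  {R : Type*} [Field R] [LinearOrder R] [IsStrictOrderedRing R]

omit [Fintype V] [DecidableEq V] [LinearOrder R] [IsStrictOrderedRing R] in
/-- `YDelta.deltaL` in the spelling of `delta_split`. -/
lemma deltaL_eq (p : E → R) (ends : E → Sym2 V) (o a₁ a₂ a₃ b : V) :
    deltaL p ends o a₁ a₂ a₃ b =
      prob p ((connEvent ends a₁ a₂)ᶜ ∩ connEvent ends a₁ o ∩ connEvent ends a₂ a₃ ∩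
          connEvent ends a₁ b) -
        prob p ((connEvent ends a₁ a₂)ᶜ ∩ connEvent ends a₁ o ∩ connEvent ends a₂ a₃ ∩
          connEvent ends a₂ b) := by
  unfold deltaL
  have e : ∀ X : Set (Config E), TEvent ends a₁ a₂ a₃ ∩ connEvent ends a₁ o ∩ X =
      (connEvent ends a₁ a₂)ᶜ ∩ connEvent ends a₁ o ∩ connEvent ends a₂ a₃ ∩ X := by
    intro X
    ext ω
    simp only [TEvent, Set.mem_inter_iff, Set.mem_compl_iff, mem_connEvent]
    constructor
    · rintro ⟨⟨⟨h21, h23⟩, h1o⟩, hX⟩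
      exact ⟨⟨⟨fun h => h21 (conn_symm h), h1o⟩, h23⟩, hX⟩
    · rintro ⟨⟨⟨h12, h1o⟩, h23⟩, hX⟩
      exact ⟨⟨⟨fun h => h12 (conn_symm h), h23⟩, h1o⟩, hX⟩
  rw [e, e]

omit [Fintype V] [DecidableEq V] [LinearOrder R] [IsStrictOrderedRing R] in
/-- `YDelta.deltaH` in the spelling of `delta_split`. -/
lemma deltaH_eq (p : E → R) (ends : E → Sym2 V) (o a₁ a₂ a₃ b : V) :
    deltaH p ends o a₁ a₂ a₃ b =
      prob p ((connEvent ends a₁ a₂)ᶜ ∩ connEvent ends a₂ o ∩ connEvent ends a₁ a₃ ∩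
          connEvent ends a₂ b) -
        prob p ((connEvent ends a₁ a₂)ᶜ ∩ connEvent ends a₂ o ∩ connEvent ends a₁ a₃ ∩
          connEvent ends a₁ b) := by
  unfold deltaH
  have e : ∀ X : Set (Config E), TEvent ends a₂ a₁ a₃ ∩ connEvent ends a₂ o ∩ X =
      (connEvent ends a₁ a₂)ᶜ ∩ connEvent ends a₂ o ∩ connEvent ends a₁ a₃ ∩ X := by
    intro X
    ext ω
    simp only [TEvent, Set.mem_inter_iff, Set.mem_compl_iff, mem_connEvent]
    constructor
    · rintro ⟨⟨⟨h12, h13⟩, h2o⟩, hX⟩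
      exact ⟨⟨⟨h12, h2o⟩, h13⟩, hX⟩
    · rintro ⟨⟨⟨h12, h2o⟩, h13⟩, hX⟩
      exact ⟨⟨⟨h12, h13⟩, h2o⟩, hX⟩
  rw [e, e]

/-- **SC′ from Z** (one hypothesis = the body of `ZDelta`): with (N0) (`n0`) and the orders
`P(a₃ ↔ b) ≤ P(a₁ ↔ b) ≤ P(a₂ ↔ b)`, `SCPrimeIneq p ends o a₃ a₁ a₂ b`. -/
theorem scprime_of_Zsum (p : E → R) (hp : IsProbVec p) (ends : E → Sym2 V) {o a₁ a₂ a₃ b : V}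
    (h12 : a₁ ≠ a₂) (h31 : a₃ ≠ a₁) (ho : o ≠ a₁) (hPD : 0 < prob p (PDEvent ends a₁ a₂ a₃))
    (hZ : ((prob p (PDEvent ends a₁ a₂ a₃ ∩ connEvent ends a₁ o ∩ connEvent ends a₂ b) -
          deltaL p ends o a₁ a₂ a₃ b) +
        (prob p (PDEvent ends a₁ a₂ a₃ ∩ connEvent ends a₂ o ∩ connEvent ends a₁ b) -
          deltaH p ends o a₁ a₂ a₃ b)) * prob p (PDEvent ends a₁ a₂ a₃) ≤
      (prob p (PDEvent ends a₁ a₂ a₃ ∩ connEvent ends a₁ o) +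
          prob p (PDEvent ends a₁ a₂ a₃ ∩ connEvent ends a₂ o)) *
        (massM2 p ends a₁ a₂ a₃ b + deltaT p ends a₁ a₂ a₃ b))
    (hord : prob p (connEvent ends a₁ b) ≤ prob p (connEvent ends a₂ b))
    (h3 : prob p (connEvent ends a₃ b) ≤ prob p (connEvent ends a₁ b)) :
    SCPrimeIneq p ends o a₃ a₁ a₂ b := by
  unfold SCPrimeIneq
  rw [gap_prime_eq, corr_eq]
  have hphi : prob p (inU ends a₁ a₂ o ∩ (inU ends a₁ a₂ a₃)ᶜ) / prob p (inU ends a₁ a₂ a₃)ᶜ =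
      phi p ends o a₁ a₂ a₃ := rfl
  rw [hphi]
  set W := massM2 p ends a₁ a₂ a₃ b + deltaT p ends a₁ a₂ a₃ b with hW
  have hW0 : 0 ≤ W := by
    have h1 : 0 ≤ massM2 p ends a₁ a₂ a₃ b := prob_nonneg hp _
    have h2 : 0 ≤ deltaT p ends a₁ a₂ a₃ b := by
      have := hf2_deltaT_nonneg p hp ends a₂ a₁ a₃ b hord
      unfold deltaT TEvent
      exact this
    linarith
  have hsum : prob p (PDEvent ends a₁ a₂ a₃ ∩ connEvent ends a₁ o) +
      prob p (PDEvent ends a₁ a₂ a₃ ∩ connEvent ends a₂ o) =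
      prob p (inU ends a₁ a₂ o ∩ PDEvent ends a₁ a₂ a₃) := by
    rw [zr_inU_PD_eq_union, prob_union_of_disjoint p (zr_PD_disjoint_o ends o a₁ a₂ a₃)]
  have hdelta := delta_split p ends o a₁ a₂ a₃ b
  rw [deltaL_eq, deltaH_eq, hsum] at hZ
  have hZ' : (splitMass p ends o a₁ a₂ a₃ b -
      (prob p (split ends a₁ a₂ o a₃ ∩ connEvent ends o b) -
        prob p (split ends a₁ a₂ o a₃ ∩ connEvent ends a₃ b))) * prob p (PDEvent ends a₁ a₂ a₃) ≤
      prob p (inU ends a₁ a₂ o ∩ PDEvent ends a₁ a₂ a₃) * W := by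
    unfold splitMass
    rw [hdelta]
    convert hZ using 2
    ring
  have hn0 := n0 p hp ends h12 h31 ho hPD
  have hle : splitMass p ends o a₁ a₂ a₃ b -
      (prob p (split ends a₁ a₂ o a₃ ∩ connEvent ends o b) -
        prob p (split ends a₁ a₂ o a₃ ∩ connEvent ends a₃ b)) ≤ phi p ends o a₁ a₂ a₃ * W := by
    have h1 : prob p (inU ends a₁ a₂ o ∩ PDEvent ends a₁ a₂ a₃) * W ≤
        phi p ends o a₁ a₂ a₃ * W * prob p (PDEvent ends a₁ a₂ a₃) := by
      rw [div_le_iff₀ hPD] at hn0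
      calc prob p (inU ends a₁ a₂ o ∩ PDEvent ends a₁ a₂ a₃) * W ≤
          phi p ends o a₁ a₂ a₃ * prob p (PDEvent ends a₁ a₂ a₃) * W :=
            mul_le_mul_of_nonneg_right hn0 hW0
        _ = phi p ends o a₁ a₂ a₃ * W * prob p (PDEvent ends a₁ a₂ a₃) := by ring
    exact le_of_mul_le_mul_right (hZ'.trans h1) hPD
  have hY := Y_slack_eq p ends o a₁ a₂ a₃ b
  have hphi0 : 0 ≤ phi p ends o a₁ a₂ a₃ := phi_nonneg hp ends o a₁ a₂ a₃
  have hmargin : phi p ends o a₁ a₂ a₃ *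
      (prob p (connEvent ends a₃ b) - prob p (connEvent ends a₁ b)) ≤ 0 :=
    mul_nonpos_of_nonneg_of_nonpos hphi0 (by linarith)
  rw [ge_iff_le]
  rw [← hW] at hY
  linarith

/-- **R2′(3) from Z** (one hypothesis): the hypotheses of `scprime_of_Zsum` plus the distinctness
needed by the merged-graph R10 give `P(o ↔ A, o ↔ b) ≥ P(o ↔ A, a₃ ↔ b)`, `A = {a₃, a₁, a₂}`. -/
theorem r2prime3_of_Zsum (p : E → R) (hp : IsProbVec p) (ends : E → Sym2 V) {o a₁ a₂ a₃ b : V}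
    (h12 : a₁ ≠ a₂) (h31 : a₃ ≠ a₁) (h32 : a₃ ≠ a₂) (ho : o ≠ a₁) (ho2 : o ≠ a₂) (hb2 : b ≠ a₂)
    (hPD : 0 < prob p (PDEvent ends a₁ a₂ a₃))
    (hZ : ((prob p (PDEvent ends a₁ a₂ a₃ ∩ connEvent ends a₁ o ∩ connEvent ends a₂ b) -
          deltaL p ends o a₁ a₂ a₃ b) +
        (prob p (PDEvent ends a₁ a₂ a₃ ∩ connEvent ends a₂ o ∩ connEvent ends a₁ b) -
          deltaH p ends o a₁ a₂ a₃ b)) * prob p (PDEvent ends a₁ a₂ a₃) ≤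
      (prob p (PDEvent ends a₁ a₂ a₃ ∩ connEvent ends a₁ o) +
          prob p (PDEvent ends a₁ a₂ a₃ ∩ connEvent ends a₂ o)) *
        (massM2 p ends a₁ a₂ a₃ b + deltaT p ends a₁ a₂ a₃ b))
    (hord : prob p (connEvent ends a₁ b) ≤ prob p (connEvent ends a₂ b))
    (h3 : prob p (connEvent ends a₃ b) ≤ prob p (connEvent ends a₁ b)) :
    prob p (hitEvent ends o {a₃, a₁, a₂} ∩ connEvent ends o b) ≥
      prob p (hitEvent ends o {a₃, a₁, a₂} ∩ connEvent ends a₃ b) :=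
  r2prime3_of_quant_of_SC p ends o a₃ a₁ a₂ b
    (orderPreserving_quant_union p hp ends h12 ho2 h32 hb2)
    (scprime_of_Zsum p hp ends h12 h31 ho hPD hZ hord h3)

end ZSum

end Summit.Ventures.PercRepro2
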